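import Summits.Ventures.HodgeRepro2.T5SU11KernelEnds
import Summits.Ventures.HodgeRepro2.T5SU11ResolventNeumannOrigin

/-!
# Summary XXIX — the kernel at the two ends, the resolvent at the origin, and the Neumann condition (rows 624–626),
under uniform names

Throughout `μ = λ(λ − 2)`, `K_λ` the kernel of `G^I_λ = −χ_λ B^I − φ_λ A^I`, `K_λ^{∘(n+1)}(t, s) = (G^I_λ)ⁿ K_λ(·, s)(t)` the composed
kernels, `c` Harish-Chandra's `c`-function.

* `kernel_origin_value`, `kernel_decay_limit`, `kernel_decay_sharp` — **`K_λ(t, s) → −χ_λ(s)` as `t → 0⁺`;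
  `e^{λs} K_λ(t, s) → −φ_λ(a_t)/((λ − 1) c(2 − λ))` as `s → ∞`; the rate `λ` is sharp** (row 624);
* `resolvent_origin_value`, `kernel_comp_origin_value`, `kernel_neumann` — **`G^I_λ g(t) → −∫ χ_λ g sinh 2s ds` as `t → 0⁺`, the
  composed kernels' boundary values, `∂_t K_λ(0⁺, s) = 0`** (row 625);
* `inner_integral_sq_bound`, `resolvent_deriv_origin`, `kernel_comp_neumann` — **`|B^I(t)| ≤ 2 Φ M cosh 2 · t²`;
  `(G^I_λ g)′(t) → 0` as `t → 0⁺`; every composed kernel satisfies the Neumann condition** (row 626).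

Nothing is claimed about (N).

Blind lane: Mathlib + the HodgeRepro2 prefix only; no sorry; axioms ⊆ {propext, Classical.choice,
Quot.sound}.
-/

namespace Summit.Ventures.HodgeRepro2.T5SU11RadialSummaryXXIX

open Filter Topology MeasureTheory
open Set (Ioi Ioc Icc Ici)
open T5SU11Cartan T5SU11SphericalFunction T5SU11SphericalAsymptotic T5SU11SphericalDecay T5SU11RadialGreenKernel
  T5SU11RadialGreenImproper T5SU11KernelEnds T5SU11ResolventOrigin T5SU11ResolventNeumannOrigin

section measure

variable [MeasurableSpace Circle] [BorelSpace Circle]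

/-- **`K_λ(t, s) → −χ_λ(s)` as `t → 0⁺`** (row 624). -/
theorem kernel_origin_value (lam : ℝ) {s : ℝ} (hs : 0 < s) :
    Tendsto (fun t => sphGreenKernel lam t s) (𝓝[>] 0) (𝓝 (-sphDecay lam s)) :=
  tendsto_kernel_nhdsGT_zero lam hs

variable {lam : ℝ} (hlam : 1 < lam)

include hlam in
/-- **`e^{λs} K_λ(t, s) → −φ_λ(a_t)/((λ − 1) c(2 − λ))` as `s → ∞`** (row 624). -/
theorem kernel_decay_limit (t : ℝ) :
    Tendsto (fun s => Real.exp (lam * s) * sphGreenKernel lam t s) atTop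
      (𝓝 (-(sph lam (hyp t) * (1 / ((lam - 1) * cfun (2 - lam)))))) :=
  tendsto_exp_mul_kernel_atTop hlam t

include hlam in
/-- **The decay rate `λ` is sharp** (row 624). -/
theorem kernel_decay_sharp (t : ℝ) {ε : ℝ} (hε : ε < lam) :
    Tendsto (fun s => Real.exp (ε * s) * sphGreenKernel lam t s) atTop (𝓝 0) ∧
      -(sph lam (hyp t) * (1 / ((lam - 1) * cfun (2 - lam)))) ≠ 0 :=
  kernel_decay_rate hlam t hε

include hlam in
/-- **`G^I_λ g(t) → −∫_{(0,∞)} χ_λ g sinh 2s ds` as `t → 0⁺`** (row 625). -/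
theorem resolvent_origin_value {g : ℝ → ℝ} {M : ℝ} (hM : ∀ s ∈ Ioc (0 : ℝ) 1, |g s| ≤ M) (hM0 : 0 ≤ M)
    (hA : IntegrableOn (fun s => sphDecay lam s * g s * Real.sinh (2 * s)) (Ioi 0)) :
    Tendsto (greenSolI (fun t => sph lam (hyp t)) (sphDecay lam) g) (𝓝[>] 0)
      (𝓝 (-∫ s in Ioi 0, sphDecay lam s * g s * Real.sinh (2 * s))) :=
  tendsto_greenSolI_nhdsGT_zero hlam hM hM0 hA

include hlam in
/-- **The composed kernels at the origin** (row 625). -/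
theorem kernel_comp_origin_value {s : ℝ} (hs : 0 < s) (n : ℕ) :
    Tendsto (fun t => ((greenSolI (fun t => sph lam (hyp t)) (sphDecay lam))^[n + 1] (fun r => sphGreenKernel lam r s)) t)
      (𝓝[>] 0)
      (𝓝 (-∫ r in Ioi 0, sphDecay lam r
        * ((greenSolI (fun t => sph lam (hyp t)) (sphDecay lam))^[n] (fun r => sphGreenKernel lam r s)) r
        * Real.sinh (2 * r))) :=
  tendsto_kernel_comp_nhdsGT_zero hlam hs n

/-- **The Neumann condition of the kernel** `∂_t K_λ(0⁺, s) = 0` (row 625). -/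
theorem kernel_neumann (lam : ℝ) {s : ℝ} (hs : 0 < s) :
    HasDerivWithinAt (fun t => sphGreenKernel lam t s) 0 (Ici 0) 0 :=
  hasDerivWithinAt_kernel_zero lam hs

/-- **`|B^I(t)| ≤ 2 Φ M cosh 2 · t²`** for `0 < t ≤ 1` (row 626). -/
theorem inner_integral_sq_bound {g : ℝ → ℝ} {M : ℝ} (hM : ∀ s ∈ Ioc (0 : ℝ) 1, |g s| ≤ M) (hM0 : 0 ≤ M)
    {Φ : ℝ} (hΦ : ∀ s ∈ Icc (0 : ℝ) 1, sph lam (hyp s) ≤ Φ) (hΦ0 : 0 ≤ Φ) {t : ℝ} (ht : 0 < t) (ht1 : t ≤ 1) :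
    |greenBI (fun t => sph lam (hyp t)) g t| ≤ 2 * Φ * M * Real.cosh 2 * t ^ 2 :=
  abs_greenBI_le_sq hM hM0 hΦ hΦ0 ht ht1

include hlam in
/-- **The Neumann condition of the resolvent**: `(G^I_λ g)′(t) → 0` as `t → 0⁺` (row 626). -/
theorem resolvent_deriv_origin {g : ℝ → ℝ} {M : ℝ} (hM : ∀ s ∈ Ioc (0 : ℝ) 1, |g s| ≤ M) (hM0 : 0 ≤ M)
    (hA : IntegrableOn (fun s => sphDecay lam s * g s * Real.sinh (2 * s)) (Ioi 0)) :
    Tendsto (greenSolI' (deriv fun t => sph lam (hyp t)) (sphDecay' lam) (fun t => sph lam (hyp t)) (sphDecay lam) g)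
      (𝓝[>] 0) (𝓝 0) :=
  tendsto_greenSolI'_nhdsGT_zero hlam hM hM0 hA

include hlam in
/-- **Every composed kernel satisfies the Neumann condition at the origin** (row 626). -/
theorem kernel_comp_neumann {s : ℝ} (hs : 0 < s) (n : ℕ) :
    Tendsto (greenSolI' (deriv fun t => sph lam (hyp t)) (sphDecay' lam) (fun t => sph lam (hyp t)) (sphDecay lam)
        ((greenSolI (fun t => sph lam (hyp t)) (sphDecay lam))^[n] (fun r => sphGreenKernel lam r s)))
      (𝓝[>] 0) (𝓝 0) :=
  tendsto_deriv_kernel_comp_nhdsGT_zero hlam hs n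

end measure

end Summit.Ventures.HodgeRepro2.T5SU11RadialSummaryXXIX
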